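import Summits.AtomisticToContinuum.HydrodynamicLimit.Theorems.CollisionIsometryCLTCollisionalTransferLocalityDefs
import Literature.MathematicalPhysics.KineticTheory.LinearLorentzBoltzmannDuality
import Literature.MathematicalPhysics.KineticTheory.HardSphereEulerProofs
import Literature.Analysis.FunctionSpaces.TorusCalculusProofs
import HarnessLib

/-!
# The lever of the line `hemisphere-affine-slaving`: `chaosAvg = affW` (stub `stub_affineSlaving`)

Registered stub `stub_affineSlaving : AffineSlavingIdentity` of crux stmt-AtomisticToContinuum-9518
(`CollisionalTransferLocality`; routes `CollisionIsometryCLT` / `StiffCollisionalRelaxation`) on the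
lead's vocabulary file `CollisionIsometryCLTCollisionalTransferLocalityDefs`. Content: (i) the sphere
moments `∫_{S²} ω_aω_bω_cω_d dσ = (4π/15)(δδ+δδ+δδ)` for `σ = volume.toSphere` (mass `4π`) by invariance
of `σ` under linear isometries (`integral_sphere_comp_isometry`: a coordinate reflection, the cyclic
permutation, one rational rotation — no polar coordinates), whence the two flux moments of the lever;
(ii) the pair-to-single collapse of the block pair sums under the centring `Σ φ_i (v_i - ū) = 0`;
(iii) `tr M = 3ρ̄θ̄` and the bookkeeping producing Enskog's `2/5`, `3/5` (Chapman–Cowling 1970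
§16.4–16.6; Soto 2016 §4.8.1) and the degenerate-block guard `ρ̄θ̄ = 0 ⇒ chaosDen = 0`. [folklore]
-/

namespace Summit.AtomisticToContinuum.HydrodynamicLimit.Theorems.HemisphereAffineSlaving

open scoped BigOperators Topology Manifold Classical MeasureTheory ProbabilityTheory Matrix InnerProductSpace ComplexConjugate ContinuousMap ENNReal
open Filter Set Function TopologicalSpace MeasureTheory Metric

noncomputable section

open Literature.MathematicalPhysics.KineticTheory (T3 V3)

/-! ## Sphere moments by isometry invariance -/

/-- Continuous functions on the unit sphere are integrable for the surface measure. [folklore] -/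
private theorem integrable_sph {f : sphere (0 : V3) 1 → ℝ} (hf : Continuous f) :
    Integrable f (volume : Measure V3).toSphere :=
  hf.integrable_of_hasCompactSupport (HasCompactSupport.of_compactSpace f)

/-- Inner product of `V3` in coordinates. [folklore] -/
private theorem inner_three (x y : V3) : inner ℝ x y = x 0 * y 0 + x 1 * y 1 + x 2 * y 2 := by
  simp [PiLp.inner_apply, Fin.sum_univ_three, mul_comm]

/-- Squared norm of `V3` in coordinates. [folklore] -/
private theorem norm_sq_three (x : V3) : ‖x‖ ^ 2 = x 0 ^ 2 + x 1 ^ 2 + x 2 ^ 2 := by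
  rw [EuclideanSpace.real_norm_sq_eq, Fin.sum_univ_three]

/-- On the unit sphere `ω₀² + ω₁² + ω₂² = 1`. [folklore] -/
private theorem sph_sum_sq (ω : sphere (0 : V3) 1) :
    (ω : V3) 0 ^ 2 + (ω : V3) 1 ^ 2 + (ω : V3) 2 ^ 2 = 1 := by
  rw [← norm_sq_three, norm_eq_of_mem_sphere ω, one_pow]

open Literature.MathematicalPhysics.KineticTheory in
/-- Change of variables on `S²` under an orthogonal matrix (`integral_sphere_comp_isometry`). [folklore] -/
private theorem integral_sph_matrix (M : Matrix (Fin 3) (Fin 3) ℝ)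
    (hM : ∀ v : V3, ∑ i, ‖Matrix.toEuclideanLin M v i‖ ^ 2 = ∑ i, ‖v i‖ ^ 2) (F : V3 → ℝ) :
    ∫ ω, F (Matrix.toEuclideanLin M (ω : V3)) ∂(volume : Measure V3).toSphere =
      ∫ ω, F ω ∂(volume : Measure V3).toSphere := by
  let L : V3 →ₗᵢ[ℝ] V3 :=
    ⟨Matrix.toEuclideanLin M, fun v => by rw [EuclideanSpace.norm_eq, EuclideanSpace.norm_eq, hM]⟩
  let A : V3 ≃ₗᵢ[ℝ] V3 := L.toLinearIsometryEquiv rfl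
  simpa [sphereMeasure, A, L] using integral_sphere_comp_isometry A fun ω => F ω

/-- **Fourth moments of the surface measure of `S²`** (`σ = volume.toSphere`, mass `4π`):
`∫ ω_a ω_b ω_c ω_d dσ = (4π/15)(δ_ab δ_cd + δ_ac δ_bd + δ_ad δ_bc)`, by invariance of `σ` under a
coordinate reflection, the cyclic permutation and one rational rotation (no polar coordinates). [folklore] -/
theorem integral_sphere_coord_four (a b c d : Fin 3) :
    ∫ ω, (ω : V3) a * (ω : V3) b * (ω : V3) c * (ω : V3) d ∂(volume : Measure V3).toSphere =
      4 * Real.pi / 15 * ((if a = b ∧ c = d then 1 else 0) + (if a = c ∧ b = d then 1 else 0) +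
        (if a = d ∧ b = c then 1 else 0)) := by
  -- the monomial moments `J i j k = ∫ ω₀^i ω₁^j ω₂^k dσ`, kept opaque
  obtain ⟨J, hJ⟩ : ∃ J : ℕ → ℕ → ℕ → ℝ, ∀ i j k, J i j k =
      ∫ ω, (ω : V3) 0 ^ i * (ω : V3) 1 ^ j * (ω : V3) 2 ^ k ∂(volume : Measure V3).toSphere :=
    ⟨_, fun _ _ _ => rfl⟩
  have J000 : J 0 0 0 = 4 * Real.pi := by  -- mass (`toSphere_real_apply_univ`, `volume_ball_fin_three`)
    rw [hJ]; simp only [pow_zero, mul_one]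
    rw [integral_const, smul_eq_mul, mul_one, Measure.toSphere_real_apply_univ, finrank_euclideanSpace_fin,
      Measure.real, EuclideanSpace.volume_ball_fin_three, ENNReal.toReal_mul, ← ENNReal.ofReal_pow
      zero_le_one, ENNReal.toReal_ofReal (by positivity), ENNReal.toReal_ofReal (by positivity)]
    ring
  have J_odd0 : ∀ {i : ℕ}, Odd i → ∀ j k, J i j k = 0 := fun {i} hi j k => by  -- reflection `ω₀ ↦ -ω₀`
    have h : -J i j k = J i j k := by
      rw [hJ, ← integral_neg, ← integral_sph_matrix !![(-1 : ℝ), 0, 0; 0, 1, 0; 0, 0, 1]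
        (fun v => by simp [Matrix.toLpLin_apply, dotProduct, Fin.sum_univ_three])
        (fun v => v 0 ^ i * v 1 ^ j * v 2 ^ k)]
      exact integral_congr_ae (Eventually.of_forall fun ω => by
        simp [Matrix.toLpLin_apply, dotProduct, Fin.sum_univ_three, hi.neg_pow])
    linarith
  have J_cyc : ∀ i j k, J i j k = J j k i := fun i j k => by  -- cyclic permutation of coordinates
    rw [hJ, hJ]
    refine Eq.trans (integral_congr_ae (Eventually.of_forall fun ω => ?_))
      (integral_sph_matrix !![(0 : ℝ), 1, 0; 0, 0, 1; 1, 0, 0]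
        (fun v => by simp [Matrix.toLpLin_apply, dotProduct, Fin.sum_univ_three]; ring)
        (fun v => v 0 ^ j * v 1 ^ k * v 2 ^ i))
    simp [Matrix.toLpLin_apply, dotProduct, Fin.sum_univ_three, -mul_eq_mul_right_iff,
      -mul_eq_mul_left_iff]
    ring
  have J_rec : ∀ i j k, J i j k = J (i + 2) j k + J i (j + 2) k + J i j (k + 2) := fun i j k => by
    simp only [hJ]
    rw [← integral_add (integrable_sph (by fun_prop)) (integrable_sph (by fun_prop)),
      ← integral_add (integrable_sph (by fun_prop)) (integrable_sph (by fun_prop))]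
    refine integral_congr_ae (Eventually.of_forall fun ω => ?_)
    linear_combination (-((ω : V3) 0 ^ i * (ω : V3) 1 ^ j * (ω : V3) 2 ^ k)) * sph_sum_sq ω
  -- the rotation `cos = 3/5`, `sin = 4/5` of the `(ω₀, ω₁)` plane (the odd cross terms vanish):
  have J_rot : 625 * J 4 0 0 = 81 * J 4 0 0 + 864 * J 2 2 0 + 256 * J 0 4 0 := by
    have h31 : J 3 1 0 = 0 := by rw [J_cyc]; exact J_odd0 (by decide) 0 3
    have h13 : J 1 3 0 = 0 := J_odd0 (by decide) 3 0
    have h2 : 81 / 625 * J 4 0 0 - 432 / 625 * J 3 1 0 + 864 / 625 * J 2 2 0 - 768 / 625 * J 1 3 0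
        + 256 / 625 * J 0 4 0 = J 4 0 0 := by
      simp only [hJ]
      conv_rhs => rw [← integral_sph_matrix !![(3 : ℝ) / 5, -4 / 5, 0; 4 / 5, 3 / 5, 0; 0, 0, 1]
        (fun v => by simp [Matrix.toLpLin_apply, dotProduct, Fin.sum_univ_three]; ring)
        (fun v => v 0 ^ 4 * v 1 ^ 0 * v 2 ^ 0)]
      rw [← integral_const_mul, ← integral_const_mul, ← integral_const_mul, ← integral_const_mul,
        ← integral_const_mul,
        ← integral_sub (integrable_sph (by fun_prop)) (integrable_sph (by fun_prop)),
        ← integral_add (integrable_sph (by fun_prop)) (integrable_sph (by fun_prop)),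
        ← integral_sub (integrable_sph (by fun_prop)) (integrable_sph (by fun_prop)),
        ← integral_add (integrable_sph (by fun_prop)) (integrable_sph (by fun_prop))]
      exact integral_congr_ae (Eventually.of_forall fun ω => by
        simp [Matrix.toLpLin_apply, dotProduct, Fin.sum_univ_three]; ring)
    rw [h31, h13] at h2
    linarith
  obtain ⟨hB, hA⟩ : J 2 2 0 = 4 * Real.pi / 15 ∧ J 4 0 0 = 4 * Real.pi / 5 := by
    have h := J_rec 0 0 0
    rw [J000, J_cyc 0 2 0, J_cyc 0 0 2, J_cyc 0 2 0] at h
    have h2 := J_rec 2 0 0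
    rw [J_cyc 2 0 2, J_cyc 0 2 2] at h2
    have hr := J_rot
    rw [J_cyc 0 4 0] at hr
    constructor <;> linarith
  have hm : ∀ (v : V3) (l : Fin 3), v l = v 0 ^ (Pi.single l 1 : Fin 3 → ℕ) 0 *  -- `ω_l` as a monomial
      v 1 ^ (Pi.single l 1 : Fin 3 → ℕ) 1 * v 2 ^ (Pi.single l 1 : Fin 3 → ℕ) 2 := fun v l => by
    fin_cases l <;> simp
  have h : ∀ ω : sphere (0 : V3) 1, (ω : V3) a * (ω : V3) b * (ω : V3) c * (ω : V3) d =
      (ω : V3) 0 ^ (Pi.single a 1 + Pi.single b 1 + Pi.single c 1 + Pi.single d 1 : Fin 3 → ℕ) 0 *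
      (ω : V3) 1 ^ (Pi.single a 1 + Pi.single b 1 + Pi.single c 1 + Pi.single d 1 : Fin 3 → ℕ) 1 *
      (ω : V3) 2 ^ (Pi.single a 1 + Pi.single b 1 + Pi.single c 1 + Pi.single d 1 : Fin 3 → ℕ) 2 := by
    intro ω; rw [hm _ a, hm _ b, hm _ c, hm _ d]
    simp only [Pi.add_apply]; ring
  simp_rw [h, ← hJ]
  fin_cases a <;> fin_cases b <;> fin_cases c <;> fin_cases d <;>
  · simp only [Fin.zero_eta, Fin.mk_one, Fin.reduceFinMk, Fin.isValue, Fin.reduceEq, reduceIte,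
      Pi.add_apply, Pi.single_apply, Nat.reduceAdd, and_self, and_true, and_false]
    -- every odd exponent vector of degree four is odd in `ω₀` or in `ω₁`; cycle the even ones home
    first
    | rw [J_odd0 (by decide : Odd 1)]; norm_num | rw [J_odd0 (by decide : Odd 3)]; norm_num
    | rw [J_cyc, J_odd0 (by decide : Odd 1)]; norm_num | rw [J_cyc, J_odd0 (by decide : Odd 3)]; norm_num
    | rw [hA]; ring | rw [J_cyc, hA]; ring | rw [J_cyc, J_cyc, hA]; ring
    | rw [hB]; ring | rw [J_cyc, hB]; ring | rw [J_cyc, J_cyc, hB]; ring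

/-- `∫ Σ_a F_a = Σ_a ∫ F_a` on the sphere for continuous `F_a`. [folklore] -/
private theorem integral_sum_sph {ι : Type*} [Fintype ι] (F : ι → sphere (0 : V3) 1 → ℝ)
    (hF : ∀ a, Continuous (F a)) :
    ∫ ω, ∑ a, F a ω ∂(volume : Measure V3).toSphere = ∑ a, ∫ ω, F a ω ∂(volume : Measure V3).toSphere :=
  integral_finsetSum _ fun a _ => integrable_sph (hF a)

/-- Contraction of a coefficient 4-tensor against the fourth sphere moments. [folklore] -/
private theorem integral_sph_quartic (C : Fin 3 → Fin 3 → Fin 3 → Fin 3 → ℝ) :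
    ∫ ω, ∑ a, ∑ b, ∑ c, ∑ d, C a b c d * ((ω : V3) a * (ω : V3) b * (ω : V3) c * (ω : V3) d)
        ∂(volume : Measure V3).toSphere =
      4 * Real.pi / 15 * ∑ a, ∑ b, (C a a b b + C a b a b + C a b b a) := by
  rw [integral_sum_sph _ (fun a => by fun_prop)]
  have h1 : ∀ a, ∫ ω, ∑ b, ∑ c, ∑ d, C a b c d * ((ω : V3) a * (ω : V3) b * (ω : V3) c * (ω : V3) d)
      ∂(volume : Measure V3).toSphere = ∑ b, ∑ c, ∑ d, C a b c d *
        ∫ ω, (ω : V3) a * (ω : V3) b * (ω : V3) c * (ω : V3) d ∂(volume : Measure V3).toSphere := by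
    intro a
    rw [integral_sum_sph _ (fun b => by fun_prop)]
    refine Finset.sum_congr rfl fun b _ => ?_
    rw [integral_sum_sph _ (fun c => by fun_prop)]
    refine Finset.sum_congr rfl fun c _ => ?_
    rw [integral_sum_sph _ (fun d => by fun_prop)]
    exact Finset.sum_congr rfl fun d _ => integral_const_mul _ _
  simp_rw [h1, integral_sphere_coord_four]
  simp only [Fin.sum_univ_three, Fin.isValue, Fin.reduceEq, reduceIte, and_true, and_false]
  ring

/-- **Second flux moment**: `∫_{S²} ⟪g,ω⟫² dσ = (4π/3)‖g‖²`. [folklore] -/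
theorem integral_sphere_inner_sq (g : V3) :
    ∫ ω, inner ℝ g (ω : V3) ^ 2 ∂(volume : Measure V3).toSphere = 4 * Real.pi / 3 * ‖g‖ ^ 2 := by
  have h : ∀ ω : sphere (0 : V3) 1, inner ℝ g (ω : V3) ^ 2 = ∑ a, ∑ b, ∑ c, ∑ d,
      (g a * g b * if c = d then 1 else 0) * ((ω : V3) a * (ω : V3) b * (ω : V3) c * (ω : V3) d) := by
    intro ω
    simp only [inner_three, Fin.sum_univ_three, Fin.isValue, Fin.reduceEq, reduceIte]
    linear_combination (-(g 0 * (ω : V3) 0 + g 1 * (ω : V3) 1 + g 2 * (ω : V3) 2) ^ 2) * sph_sum_sq ω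
  simp_rw [h]
  rw [integral_sph_quartic]
  simp only [Fin.sum_univ_three, Fin.isValue, Fin.reduceEq, reduceIte, norm_sq_three]
  ring

/-- **Flux-weighted second and mixed third moments** (the two sphere integrals of the lever):
`∫ ⟪g,ω⟫² [ω⊗ω:G + ⟪V,ω⟫⟪ω,e⟫] dσ = (4π/15)[‖g‖²(tr G + ⟪V,e⟫) + 2 g⊗g:G + 2⟪g,V⟫⟪g,e⟫]`.
[folklore] -/
theorem integral_sphere_inner_sq_mul (g V e : V3) (G : Fin 3 → Fin 3 → ℝ) :
    ∫ ω, inner ℝ g (ω : V3) ^ 2 * ((∑ a, ∑ b, (ω : V3) a * (ω : V3) b * G a b) +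
        inner ℝ V (ω : V3) * (∑ a, (ω : V3) a * e a)) ∂(volume : Measure V3).toSphere =
      4 * Real.pi / 15 * (‖g‖ ^ 2 * ((∑ a, G a a) + inner ℝ V e) + 2 * (∑ a, ∑ b, g a * g b * G a b) +
        2 * (inner ℝ g V * inner ℝ g e)) := by
  have h : ∀ ω : sphere (0 : V3) 1, inner ℝ g (ω : V3) ^ 2 *
      ((∑ a, ∑ b, (ω : V3) a * (ω : V3) b * G a b) + inner ℝ V (ω : V3) * (∑ a, (ω : V3) a * e a)) =
      ∑ a, ∑ b, ∑ c, ∑ d,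
        (g a * g b * (G c d + V c * e d)) * ((ω : V3) a * (ω : V3) b * (ω : V3) c * (ω : V3) d) := by
    intro ω
    simp only [inner_three, Fin.sum_univ_three]
    ring
  simp_rw [h]
  rw [integral_sph_quartic]
  simp only [Fin.sum_univ_three, inner_three, norm_sq_three]
  ring

/-! ## Pair sums over the block law -/

/-- The one-dimensional pair identity behind the lever: for weights `φ` and marks `x` with `Σ φ x = 0`,
`Σ_ij φ_iφ_j (x_i-x_j)² (A + (w + (x_i+x_j)/2) B) = 2 (Σφ) Σ_i φ_i x_i² (A + (w + x_i/2) B)`. [folklore] -/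
private theorem pair_sum_identity {n : ℕ} (φ x : Fin n → ℝ) (A B w : ℝ) (h0 : ∑ i, φ i * x i = 0) :
    ∑ i, ∑ j, φ i * φ j * ((x i - x j) ^ 2 * (A + (w + (x i + x j) / 2) * B)) =
      2 * (∑ i, φ i) * ∑ i, φ i * (x i ^ 2 * (A + (w + x i / 2) * B)) := by
  have hp : ∀ i, φ i * (x i ^ 2 * (A + (w + x i / 2) * B)) =
      φ i * (x i ^ 2 * (A + w * B) + B / 2 * x i ^ 3) := fun i => by ring
  calc _ = ∑ i, ∑ j, ((φ i * (x i ^ 2 * (A + w * B) + B / 2 * x i ^ 3)) * φ j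
            + φ i * (φ j * (x j ^ 2 * (A + w * B) + B / 2 * x j ^ 3))
            - (φ i * x i) * (φ j * (2 * (A + w * B) * x j + B / 2 * x j ^ 2))
            - (φ i * (B / 2 * x i ^ 2)) * (φ j * x j)) := by
        refine Finset.sum_congr rfl fun i _ => Finset.sum_congr rfl fun j _ => ?_
        ring
    _ = _ := by
        simp only [Finset.sum_add_distrib, Finset.sum_sub_distrib, ← Finset.sum_mul_sum, h0, hp]
        ring

/-- **Pair-to-single collapse**: under the centring `Σ φ_i (v_i - u) = 0` the pair sum of the
flux-weighted sphere integrand (relative velocity `v_i - v_j`, centre-of-mass velocity `(v_i+v_j)/2`)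
is `2 Σφ` times the single sum with `g = v_i - u`, `V = u + (v_i - u)/2`. [folklore] -/
private theorem pair_to_single {n : ℕ} (φ : Fin n → ℝ) (v : Fin n → V3) (u : V3)
    (A B : sphere (0 : V3) 1 → ℝ) (hA : Continuous A) (hB : Continuous B)
    (h0 : ∑ i, φ i • (v i - u) = 0) :
    ∑ i, ∑ j, φ i * φ j * ∫ ω, inner ℝ (v i - v j) (ω : V3) ^ 2 *
        (A ω + inner ℝ ((1 / 2 : ℝ) • (v i + v j)) (ω : V3) * B ω) ∂(volume : Measure V3).toSphere =
      2 * (∑ i, φ i) * ∑ i, φ i * ∫ ω, inner ℝ (v i - u) (ω : V3) ^ 2 *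
        (A ω + inner ℝ (u + (1 / 2 : ℝ) • (v i - u)) (ω : V3) * B ω) ∂(volume : Measure V3).toSphere := by
  have hL : ∫ ω, ∑ i, ∑ j, φ i * φ j * (inner ℝ (v i - v j) (ω : V3) ^ 2 *
      (A ω + inner ℝ ((1 / 2 : ℝ) • (v i + v j)) (ω : V3) * B ω)) ∂(volume : Measure V3).toSphere =
      ∑ i, ∑ j, φ i * φ j * ∫ ω, inner ℝ (v i - v j) (ω : V3) ^ 2 *
        (A ω + inner ℝ ((1 / 2 : ℝ) • (v i + v j)) (ω : V3) * B ω) ∂(volume : Measure V3).toSphere := by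
    rw [integral_sum_sph _ (fun i => by fun_prop)]
    refine Finset.sum_congr rfl fun i _ => ?_
    rw [integral_sum_sph _ (fun j => by fun_prop)]
    exact Finset.sum_congr rfl fun j _ => integral_const_mul _ _
  have hR : ∫ ω, ∑ i, φ i * (inner ℝ (v i - u) (ω : V3) ^ 2 *
      (A ω + inner ℝ (u + (1 / 2 : ℝ) • (v i - u)) (ω : V3) * B ω)) ∂(volume : Measure V3).toSphere =
      ∑ i, φ i * ∫ ω, inner ℝ (v i - u) (ω : V3) ^ 2 *
        (A ω + inner ℝ (u + (1 / 2 : ℝ) • (v i - u)) (ω : V3) * B ω) ∂(volume : Measure V3).toSphere := by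
    rw [integral_sum_sph _ (fun i => by fun_prop)]
    exact Finset.sum_congr rfl fun i _ => integral_const_mul _ _
  rw [← hL, ← hR, ← integral_const_mul]
  refine integral_congr_ae (Eventually.of_forall fun ω => ?_)
  have h0' : ∑ i, φ i * (inner ℝ (v i) (ω : V3) - inner ℝ u (ω : V3)) = 0 := by
    simpa [sum_inner, real_inner_smul_left, inner_sub_left] using congrArg (fun z => inner ℝ z (ω : V3)) h0
  have key := pair_sum_identity φ (fun i => inner ℝ (v i) (ω : V3) - inner ℝ u (ω : V3)) (A ω) (B ω)
    (inner ℝ u (ω : V3)) h0'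
  simp only [inner_sub_left, inner_add_left, real_inner_smul_left]
  calc _ = _ := (Finset.sum_congr rfl fun i _ => Finset.sum_congr rfl fun j _ => by ring)
    _ = _ := key
    _ = _ := by congr 1; exact Finset.sum_congr rfl fun i _ => by ring

/-- Vector-valued integrals against the empirical measure are finite averages. [folklore] -/
private theorem integral_empiricalMeasure_vec {n : ℕ}
    (z : Literature.Analysis.FluidPDE.Config n (Fin 3) T3) (F : T3 × V3 → V3) :
    ∫ y, F y ∂(Literature.Analysis.FluidPDE.empiricalMeasure z) = (n : ℝ)⁻¹ • ∑ i, F (z i) := by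
  rw [Literature.Analysis.FluidPDE.empiricalMeasure_eq, integral_smul_measure,
    integral_finsetSum_measure fun i _ => integrable_dirac enorm_lt_top]
  simp [integral_dirac, ENNReal.toReal_inv]

/-- **The lever as an identity of finite sums** (block data abstract: weights `f ≥ 0`, velocities
`v`, normalisation `cc > 0`, `G = ∇ψ`, `e = ∇χ`, `dv = tr G`, `u = m̄/ρ̄`, `p = ρ̄θ̄`): the flux-weighted
chaos average over the pair law is the guarded `(eulerW + kinW)/3`; Enskog's `2/5`, `3/5`
(Chapman–Cowling 1970 §16.4–16.6) come out of `integral_sphere_coord_four`. [folklore] -/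
private theorem block_identity {n : ℕ} (f : Fin n → ℝ) (v : Fin n → V3) (hf : ∀ i, 0 ≤ f i) {cc : ℝ}
    (hcc : 0 < cc) (G : Fin 3 → Fin 3 → ℝ) (e : V3) {dv : ℝ} (hdv : dv = ∑ a, G a a) {u : V3}
    (hu : u = (cc * ∑ i, f i)⁻¹ • (cc • ∑ i, f i • v i)) {p : ℝ}
    (hp : p = (cc * ∑ i, f i) * (2 / 3 * ((cc * ∑ i, f i * (‖v i‖ ^ 2 / 2)) / (cc * ∑ i, f i) -
      ‖cc • ∑ i, f i • v i‖ ^ 2 / (2 * (cc * ∑ i, f i) ^ 2)))) :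
    (cc * ∑ i, cc * ∑ j, f i * f j * ∫ ω, inner ℝ (v i - v j) (ω : V3) ^ 2 *
        ((∑ a, ∑ b, (ω : V3) a * (ω : V3) b * G a b) +
          inner ℝ ((1 / 2 : ℝ) • (v i + v j)) (ω : V3) * (∑ a, (ω : V3) a * e a))
            ∂(volume : Measure V3).toSphere) /
      (cc * ∑ i, cc * ∑ j, f i * f j *
        ∫ ω, inner ℝ (v i - v j) (ω : V3) ^ 2 ∂(volume : Measure V3).toSphere) =
    if p = 0 then 0 else
      (dv + ∑ j, e j * u j +
        (2 / 5 * ((∑ a, ∑ b, (cc * ∑ i, f i * ((v i a - u a) * (v i b - u b)) -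
              if a = b then (∑ l, cc * ∑ i, f i * (v i l - u l) ^ 2) / 3 else 0) * G a b) +
            (∑ a, ∑ b, (cc * ∑ i, f i * ((v i a - u a) * (v i b - u b)) -
              if a = b then (∑ l, cc * ∑ i, f i * (v i l - u l) ^ 2) / 3 else 0) * u b * e a)) / p +
          3 / 5 * (∑ a, (cc • ∑ i, (f i * ‖v i - u‖ ^ 2 / 2) • (v i - u)) a * e a) / p)) / 3 := by
  set M := ∑ i, f i • v i with hM
  have hfi : ∑ i, f i = 0 → ∀ i, f i = 0 := fun hz i =>
    (Finset.sum_eq_zero_iff_of_nonneg fun j _ => hf j).1 hz i (Finset.mem_univ _)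
  have hu' : u = (∑ i, f i)⁻¹ • M := by
    rw [hu, smul_smul]; by_cases hz : ∑ i, f i = 0
    · simp [hz]
    · congr 1; field_simp
  have h0 : ∑ i, f i • (v i - u) = 0 := by  -- the centring constraint
    simp_rw [smul_sub, Finset.sum_sub_distrib, ← Finset.sum_smul, hu', smul_smul]
    by_cases hz : ∑ i, f i = 0
    · simp [hM, hfi hz]
    · rw [mul_inv_cancel₀ hz, one_smul, sub_self]
  -- pair sums → single sums → sphere moments
  have hA : Continuous fun ω : sphere (0 : V3) 1 => ∑ a, ∑ b, (ω : V3) a * (ω : V3) b * G a b := by fun_prop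
  have hB : Continuous fun ω : sphere (0 : V3) 1 => ∑ a, (ω : V3) a * e a := by fun_prop
  have hN := pair_to_single f v u _ _ hA hB h0
  have hD := pair_to_single f v u (fun _ => (1 : ℝ)) (fun _ => (0 : ℝ)) continuous_const
    continuous_const h0
  simp only [mul_zero, add_zero, mul_one] at hD
  conv_lhs => rw [← Finset.mul_sum, ← Finset.mul_sum, hN, hD]
  simp_rw [integral_sphere_inner_sq_mul, integral_sphere_inner_sq]
  -- the single sums, structured
  have hSB : ∑ i, f i * (4 * Real.pi / 15 * (‖v i - u‖ ^ 2 * ((∑ a, G a a) +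
        inner ℝ (u + (1 / 2 : ℝ) • (v i - u)) e) + 2 * (∑ a, ∑ b, (v i - u) a * (v i - u) b * G a b) +
        2 * (inner ℝ (v i - u) (u + (1 / 2 : ℝ) • (v i - u)) * inner ℝ (v i - u) e))) =
      4 * Real.pi / 15 * ((dv + ∑ j, e j * u j) * ∑ i, f i * ‖v i - u‖ ^ 2 +
        2 * (∑ i, f i * ∑ a, ∑ b, (v i a - u a) * (v i b - u b) * (G a b + u b * e a)) +
        3 / 2 * ∑ i, f i * (‖v i - u‖ ^ 2 * inner ℝ (v i - u) e)) := by
    simp only [hdv, Finset.mul_sum, ← Finset.sum_add_distrib, Fin.sum_univ_three, inner_three,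
      norm_sq_three, PiLp.add_apply, PiLp.sub_apply, PiLp.smul_apply, smul_eq_mul]
    exact Finset.sum_congr rfl fun i _ => by ring
  have hX1 : ((∑ a, ∑ b, (cc * ∑ i, f i * ((v i a - u a) * (v i b - u b)) -
              if a = b then (∑ l, cc * ∑ i, f i * (v i l - u l) ^ 2) / 3 else 0) * G a b) +
            (∑ a, ∑ b, (cc * ∑ i, f i * ((v i a - u a) * (v i b - u b)) -
              if a = b then (∑ l, cc * ∑ i, f i * (v i l - u l) ^ 2) / 3 else 0) * u b * e a)) =
      cc * (∑ i, f i * ∑ a, ∑ b, (v i a - u a) * (v i b - u b) * (G a b + u b * e a)) -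
        cc * (∑ i, f i * ‖v i - u‖ ^ 2) / 3 * (∑ a, G a a + ∑ j, e j * u j) := by
    simp only [Fin.sum_univ_three, Fin.isValue, Fin.reduceEq, reduceIte, sub_zero, Finset.mul_sum,
      Finset.sum_mul, Finset.sum_div, ← Finset.sum_add_distrib, ← Finset.sum_sub_distrib, norm_sq_three,
      PiLp.sub_apply]
    exact Finset.sum_congr rfl fun i _ => by ring
  have hX2 : (∑ a, (cc • ∑ i, (f i * ‖v i - u‖ ^ 2 / 2) • (v i - u)) a * e a) =
      cc * (∑ i, f i * (‖v i - u‖ ^ 2 * inner ℝ (v i - u) e)) / 2 := by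
    simp only [Fin.sum_univ_three, inner_three, PiLp.smul_apply, WithLp.ofLp_sum, Finset.sum_apply,
      PiLp.sub_apply, smul_eq_mul, Finset.mul_sum, Finset.sum_mul, Finset.sum_div,
      ← Finset.sum_add_distrib]
    exact Finset.sum_congr rfl fun i _ => by ring
  -- `tr` of the central second moment: `cc Σ f |v - u|² = 3 p`
  have hT : cc * ∑ i, f i * ‖v i - u‖ ^ 2 = 3 * p := by
    by_cases hz : ∑ i, f i = 0
    · simp [hp, hfi hz]
    have h1 : ∑ i, f i * ‖v i - u‖ ^ 2 =
        2 * (∑ i, f i * (‖v i‖ ^ 2 / 2)) - 2 * inner ℝ M u + (∑ i, f i) * ‖u‖ ^ 2 := by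
      simp only [hM, sum_inner, real_inner_smul_left, Finset.sum_mul, Finset.mul_sum,
        ← Finset.sum_sub_distrib, ← Finset.sum_add_distrib]
      exact Finset.sum_congr rfl fun i _ => by rw [norm_sub_sq_real]; ring
    rw [h1, hp, hu', real_inner_smul_right, real_inner_self_eq_norm_sq, norm_smul, norm_smul]
    simp only [Real.norm_eq_abs, mul_pow, sq_abs]
    field_simp
    ring
  have hDS : ∑ i, f i * (4 * Real.pi / 3 * ‖v i - u‖ ^ 2) = 4 * Real.pi / 3 * ∑ i, f i * ‖v i - u‖ ^ 2 := by
    rw [Finset.mul_sum]; exact Finset.sum_congr rfl fun i _ => by ring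
  rw [hSB, hDS, hX1, hX2]
  by_cases hp0 : p = 0
  · have hS0 : ∑ i, f i * ‖v i - u‖ ^ 2 = 0 := by
      have h := hT; rw [hp0, mul_zero] at h
      exact (mul_eq_zero.1 h).resolve_left hcc.ne'
    rw [if_pos hp0, hS0]; simp
  · have hz : ∑ i, f i ≠ 0 := fun h => hp0 (by rw [hp, h]; simp)
    have hS : ∑ i, f i * ‖v i - u‖ ^ 2 ≠ 0 := fun h => hp0 (by rw [h, mul_zero] at hT; linarith)
    have hp' : p = cc * (∑ i, f i * ‖v i - u‖ ^ 2) / 3 := by linarith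
    rw [if_neg hp0, hp', hdv]
    field_simp
    ring

/-- **Registered stub `stub_affineSlaving`** (THE LEVER) of crux stmt-AtomisticToContinuum-9518 (line
hemisphere-affine-slaving): for every nonnegative kernel and every test pair with a smooth slice
`ψ s`, the flux-weighted chaos average of the mark factor `ω⊗ω:∇ψ + (V·ω)(ω·∇χ)` over uniform normals
and the block pair law IS the guarded affine weight: `chaosAvg = affW`, i.e. off degenerate blocks
`(1/3)[div ψ + ū·∇χ + (2/5)(D:∇ψ + Dū·∇χ)/(ρ̄θ̄) + (3/5) q·∇χ/(ρ̄θ̄)]` (Enskog, Chapman–Cowling 1970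
§16.4–16.6; an exact identity of finite sums and `integral_sphere_coord_four`). [folklore] -/
theorem stub_affineSlaving : AffineSlavingIdentity := by
  intro ψ χ φ N s w x hψ hφ
  have hdv : divPsi ψ s x = ∑ a, gradPsi ψ s x a a := by
    simp only [divPsi, gradPsi, Literature.Analysis.FunctionSpaces.Torus.divergence]
    refine Finset.sum_congr rfl fun a _ => ?_
    open Literature.Analysis.FunctionSpaces in
    rw [Torus.partialDeriv_eq_fderiv_apply ((hψ.apply a).isContDiff (by simp)),
      ← Torus.inner_gradient_left, EuclideanSpace.inner_single_right]
    simp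
  simp only [chaosAvg, chaosNum, chaosDen, sphNum, sphDen, affW, eulerW, kinW, Dst, qfl,
    Literature.Analysis.FluidPDE.integral_empiricalMeasure, integral_empiricalMeasure_vec]
  refine block_identity (fun i => φ N ((w i).1 - x)) (fun i => (w i).2) (fun i => hφ _) (by positivity)
    (gradPsi ψ s x) (gradChi χ s x) hdv ?_ ?_
  · simp only [uB, rhoB, mB, Literature.MathematicalPhysics.KineticTheory.empiricalDensityField_eq_sum,
      Literature.MathematicalPhysics.KineticTheory.empiricalMomentumField_eq_sum]
  · simp only [pkin, thetaB, rhoB, EB, mB,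
      Literature.MathematicalPhysics.KineticTheory.empiricalDensityField_eq_sum,
      Literature.MathematicalPhysics.KineticTheory.empiricalMomentumField_eq_sum,
      Literature.MathematicalPhysics.KineticTheory.empiricalEnergyField_eq_sum]

end

end Summit.AtomisticToContinuum.HydrodynamicLimit.Theorems.HemisphereAffineSlaving
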